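import Summits.QuantumFields.YangMills.Theorems.SwapVirialDeficitZeroModeGroupFourSmallBallCone
import HarnessLib

/-!
# Exact zero-mode rung, FOUR pairwise nearly commuting letters — II: the EXACT `t⁶`-scaling identity
# (zero-mode block of crux ⟨stmt-QuantumFields-24497⟩ `ToronTubeVolumeLaw`; free-hands support of ⟨stmt-QuantumFields-24197⟩ / ⟨24497⟩)

With the hub on the `i`-axis, the three transverse dilations `D_t` (w2 g55's ✓`ZeroModeGroup.dilate`) of the non-hub letters `((x, y), z)` turn the
section `fourSet t a` into the `t`-REGULAR event `rescaledSet4 t² a` (part I), at the cost of the Jacobian `(t²)³ = t⁶` — EXACTLY the power of the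
small-ball law of `N₄`.  Here this is done by ONE change of variables on `(ℍ × ℍ) × ℍ` (push-forward of Lebesgue measure under the product dilation,
`Measure.map_prod_map` + `Measure.map_linearMap_addHaar_eq_smul_addHaar`), not by iterated integrals:
* §4 `map_dilate_volume`, `map_dilate3_volume` (`(D_t × D_t × D_t)_* vol³ = (t²)⁻³·vol³`), `coneThree_eq_smul_restrict` (`coneThree = coneConst³·vol³|_{B³}`);
* §5 the per-constraint equivalences `commSq_dilate_pair_le_iff` / `commSq_dilate_hub_le_iff` / `dilate_mem_ball_iff` and ★ `dilate3_mem_fourSet_iff`;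
* §6 ★★ `phiFour_axis_eq_scaled` — `φ⁴_t(a) = coneConst³·(t²)³·vol³(rescaledSet4 t² a)` for an axis hub, `t > 0`; ★★ `haar_nearlyCommuting_eq_scaled` —
  `Haar⁴(N₄(t)) = t⁶·coneConst³·∫dcone(a) vol³(G⁴_{t²}(re a + ‖Im a‖·i))`.  The `log(1/t)` of `N₄` is therefore carried entirely by the hub integral
  of a `t`-regular event whose `s → 0` limit has a non-integrable pole at the central hubs (part III, future work).
HONEST LABEL: finite-dimensional measure theory on `SU(2)⁴` (plan-level zero-mode rung of DRAFT lines); NOT ⟨24497⟩, NOT ⟨24197⟩; the Yang–Mills mass gap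
is NOT proved; no summit is proved by a line.  Seat ym-line-fcl-p3 g44, `--supports stmt-QuantumFields-24197`.  THEOREMS ONLY, standard axioms.
References: [cite: GonzalezarroyoAltes1988]; [cite: Vanbaal2001]; [cite: Luscher1983, §2]; [folklore].
-/

set_option autoImplicit false

noncomputable section

open MeasureTheory Quaternion Set
open scoped Quaternion ENNReal BigOperators
open Literature.MathematicalPhysics.QuantumLattice
open Literature.MathematicalPhysics.QuantumFieldTheory (haarProbability)
open Summit.QuantumFields.YangMills.Theorems.SwapTwistDeficit.ToronLog
open Summit.QuantumFields.YangMills.Theorems.SwapVirialDeficit.ZeroModeSigma (coneThree coneThree_def isProbabilityMeasure_coneThree)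

attribute [local instance] Literature.Analysis.FluidPDE.Tao2016.quatMeasurableSpace
  Literature.Analysis.FluidPDE.Tao2016.quatBorelSpace
  Literature.MathematicalPhysics.QuantumLattice.secondCountableTopology_su2

namespace Summit.QuantumFields.YangMills.Theorems.SwapVirialDeficit.ZeroModeGroup

/-! ## §4 Push-forwards of Lebesgue measure under the dilations; `coneThree` as a restricted Lebesgue measure -/

/-- `(D_t)_* vol = (t²)⁻¹ · vol` (`t ≠ 0`, `det D_t = t²`). [folklore] -/
theorem map_dilate_volume {t : ℝ} (ht : t ≠ 0) :
    Measure.map (dilate t) (volume : Measure ℍ) = ENNReal.ofReal ((t ^ 2)⁻¹) • (volume : Measure ℍ) := by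
  have hdet : LinearMap.det (dilate t) ≠ 0 := by rw [det_dilate]; positivity
  rw [show (⇑(dilate t)) = ⇑(dilate t) from rfl, Measure.map_linearMap_addHaar_eq_smul_addHaar _ hdet, det_dilate, abs_inv, abs_of_nonneg (sq_nonneg t)]

/-- `(D_t × D_t × D_t)_* vol³ = ((t²)⁻¹)³ · vol³` on `(ℍ × ℍ) × ℍ` (`t ≠ 0`). [folklore] -/
theorem map_dilate3_volume {t : ℝ} (ht : t ≠ 0) :
    Measure.map (Prod.map (Prod.map (dilate t) (dilate t)) (dilate t)) (((volume : Measure ℍ).prod (volume : Measure ℍ)).prod (volume : Measure ℍ)) =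
      (ENNReal.ofReal ((t ^ 2)⁻¹) * ENNReal.ofReal ((t ^ 2)⁻¹) * ENNReal.ofReal ((t ^ 2)⁻¹)) •
        (((volume : Measure ℍ).prod (volume : Measure ℍ)).prod (volume : Measure ℍ)) := by
  have hD : Measurable (dilate t) := (LinearMap.continuous_of_finiteDimensional _).measurable
  rw [← Measure.map_prod_map _ _ (hD.prodMap hD) hD, ← Measure.map_prod_map _ _ hD hD, map_dilate_volume ht]
  simp only [Measure.prod_smul_left, Measure.prod_smul_right, smul_smul]
  congr 1
  ring

/-- `coneThree = coneConst³ · vol³|_{B × B × B}` as measures. [folklore] -/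
theorem coneThree_eq_smul_restrict :
    coneThree = (ENNReal.ofReal coneConst * ENNReal.ofReal coneConst * ENNReal.ofReal coneConst) •
      ((((volume : Measure ℍ).prod (volume : Measure ℍ)).prod (volume : Measure ℍ)).restrict
        ((Metric.ball (0 : ℍ) 1 ×ˢ Metric.ball (0 : ℍ) 1) ×ˢ Metric.ball (0 : ℍ) 1)) := by
  rw [coneThree_def, coneMeasure, inv_volume_ball_eq]
  simp only [Measure.prod_smul_left, Measure.prod_smul_right, smul_smul, Measure.prod_restrict]
  congr 1
  ring

/-- `coneThree S = coneConst³ · vol³((B × B × B) ∩ S)` for measurable `S`. [folklore] -/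
theorem coneThree_apply {S : Set ((ℍ × ℍ) × ℍ)} (hS : MeasurableSet S) :
    coneThree S = (ENNReal.ofReal coneConst * ENNReal.ofReal coneConst * ENNReal.ofReal coneConst) *
      (((volume : Measure ℍ).prod (volume : Measure ℍ)).prod (volume : Measure ℍ)) (S ∩ ((Metric.ball (0 : ℍ) 1 ×ˢ Metric.ball (0 : ℍ) 1) ×ˢ Metric.ball (0 : ℍ) 1)) := by
  rw [coneThree_eq_smul_restrict, Measure.smul_apply, Measure.restrict_apply hS, smul_eq_mul]

/-! ## §5 The constraints after dilation -/

/-- Ball: `D_t x ∈ B ↔ N_{t²}(x) < 1`. [folklore] -/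
theorem dilate_mem_ball_iff (t : ℝ) (x : ℍ) : dilate t x ∈ Metric.ball (0 : ℍ) 1 ↔ dilNormSq (t ^ 2) x < 1 := by
  rw [Metric.mem_ball, dist_zero_right, dilNormSq_sq_eq]
  constructor
  · intro h; nlinarith [norm_nonneg (dilate t x)]
  · intro h; nlinarith [norm_nonneg (dilate t x)]

/-- Pair: `commSq (D_t x) (D_t y) ≤ t² ↔` the multiplied-out coupled constraint at `s = t²` (`t > 0`; degenerate points included). [folklore] -/
theorem commSq_dilate_pair_le_iff {t : ℝ} (ht : 0 < t) (x y : ℍ) :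
    commSq (dilate t x) (dilate t y) ≤ t ^ 2 ↔
      4 * ((x.imK * y.imI - x.imI * y.imK) ^ 2 + (x.imI * y.imJ - x.imJ * y.imI) ^ 2 + t ^ 2 * (x.imJ * y.imK - x.imK * y.imJ) ^ 2) ≤
        dilNormSq (t ^ 2) x * dilNormSq (t ^ 2) y := by
  have h := dilate_mem_conePairSet_iff ht (a := (0 : ℍ)) rfl rfl x y
  -- read the pair constraint off the three-letter equivalence at the trivial hub `a = 0`
  have ht2 : 0 < t ^ 2 := by positivity
  rw [commSq_def, norm_comm_dilate_sq, ← dilNormSq_sq_eq, ← dilNormSq_sq_eq]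
  set A := 4 * ((x.imK * y.imI - x.imI * y.imK) ^ 2 + (x.imI * y.imJ - x.imJ * y.imI) ^ 2 + t ^ 2 * (x.imJ * y.imK - x.imK * y.imJ) ^ 2)
  set D := dilNormSq (t ^ 2) x * dilNormSq (t ^ 2) y
  have hD : 0 ≤ D := mul_nonneg (dilNormSq_nonneg ht2.le x) (dilNormSq_nonneg ht2.le y)
  have hA : 0 ≤ A := by positivity
  rcases hD.eq_or_lt with hD0 | hDpos
  · rw [← hD0, div_zero]
    have hA0 : A = 0 := by
      rcases mul_eq_zero.1 hD0.symm with h0 | h0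
      · obtain ⟨-, h1, h2, h3⟩ := coords_eq_zero_of_dilNormSq_eq_zero ht2 h0
        simp [A, h1, h2, h3]
      · obtain ⟨-, h1, h2, h3⟩ := coords_eq_zero_of_dilNormSq_eq_zero ht2 h0
        simp [A, h1, h2, h3]
    rw [hA0]
    exact ⟨fun _ => le_refl _, fun _ => ht2.le⟩
  · rw [div_le_iff₀ hDpos]
    constructor
    · intro h; nlinarith
    · intro h; nlinarith

/-- Hub: `commSq (D_t x) a ≤ t² ↔ 4a_I²(x_J²+x_K²) ≤ N_{t²}(x)‖a‖²` for an axis hub (`a_J = a_K = 0`, `t > 0`). [folklore] -/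
theorem commSq_dilate_hub_le_iff {t : ℝ} (ht : 0 < t) {a : ℍ} (hJ : a.imJ = 0) (hK : a.imK = 0) (x : ℍ) :
    commSq (dilate t x) a ≤ t ^ 2 ↔ 4 * (a.imI ^ 2 * (x.imJ ^ 2 + x.imK ^ 2)) ≤ dilNormSq (t ^ 2) x * ‖a‖ ^ 2 := by
  have ht2 : 0 < t ^ 2 := by positivity
  rw [commSq_def, norm_comm_axis_sq _ _ hJ hK, dilate_imJ, dilate_imK, ← dilNormSq_sq_eq]
  set A := 4 * (a.imI ^ 2 * (x.imJ ^ 2 + x.imK ^ 2))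
  set D := dilNormSq (t ^ 2) x * ‖a‖ ^ 2
  have hD : 0 ≤ D := mul_nonneg (dilNormSq_nonneg ht2.le x) (sq_nonneg _)
  have hnum : 4 * (a.imI ^ 2 * ((t * x.imJ) ^ 2 + (t * x.imK) ^ 2)) = t ^ 2 * A := by simp only [A]; ring
  rw [hnum]
  rcases hD.eq_or_lt with hD0 | hDpos
  · rw [← hD0, div_zero]
    have hA0 : A = 0 := by
      rcases mul_eq_zero.1 hD0.symm with h0 | h0
      · obtain ⟨-, -, h2, h3⟩ := coords_eq_zero_of_dilNormSq_eq_zero ht2 h0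
        simp [A, h2, h3]
      · have ha0 : a = 0 := by
          have : ‖a‖ = 0 := by nlinarith [norm_nonneg a]
          exact norm_eq_zero.1 this
        simp [A, ha0]
    rw [hA0]
    exact ⟨fun _ => le_refl _, fun _ => ht2.le⟩
  · rw [div_le_iff₀ hDpos]
    constructor
    · intro h; nlinarith
    · intro h; nlinarith

/-- ★ **The rescaled event, pointwise** (four letters): for `t > 0` and an axis hub,
`[(D_tx, D_ty, D_tz) ∈ B³ ∩ fourSet t a] ↔ ((x, y), z) ∈ rescaledSet4 t² a`. [folklore] -/
theorem dilate3_mem_fourSet_iff {t : ℝ} (ht : 0 < t) {a : ℍ} (hJ : a.imJ = 0) (hK : a.imK = 0) (w : (ℍ × ℍ) × ℍ) :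
    Prod.map (Prod.map (dilate t) (dilate t)) (dilate t) w ∈
        fourSet t a ∩ ((Metric.ball (0 : ℍ) 1 ×ˢ Metric.ball (0 : ℍ) 1) ×ˢ Metric.ball (0 : ℍ) 1) ↔
      w ∈ rescaledSet4 (t ^ 2) a := by
  obtain ⟨⟨x, y⟩, z⟩ := w
  simp only [Set.mem_inter_iff, Set.mem_prod, Prod.map_apply, fourSet, rescaledSet4, Set.mem_setOf_eq,
    dilate_mem_ball_iff, commSq_dilate_pair_le_iff ht, commSq_dilate_hub_le_iff ht hJ hK]
  tauto

/-! ## §6 The exact `t⁶`-scaling -/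

/-- The rescaled section is measurable. [folklore] -/
theorem measurableSet_rescaledSet4 (s : ℝ) (a : ℍ) : MeasurableSet (rescaledSet4 s a) := by
  have hx : Measurable fun w : (ℍ × ℍ) × ℍ => w.1.1 := measurable_fst.comp measurable_fst
  have hy : Measurable fun w : (ℍ × ℍ) × ℍ => w.1.2 := measurable_snd.comp measurable_fst
  have hz : Measurable fun w : (ℍ × ℍ) × ℍ => w.2 := measurable_snd
  have hN : ∀ {f : (ℍ × ℍ) × ℍ → ℍ}, Measurable f → Measurable fun w => dilNormSq s (f w) := fun hf => (continuous_dilNormSq s).measurable.comp hf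
  have hc : ∀ {f : (ℍ × ℍ) × ℍ → ℍ}, Measurable f → ∀ (g : ℍ → ℝ), Continuous g → Measurable fun w => g (f w) :=
    fun hf g hg => hg.measurable.comp hf
  have hI : Continuous fun q : ℍ => q.imI := Quaternion.continuous_imI
  have hJc : Continuous fun q : ℍ => q.imJ := Quaternion.continuous_imJ
  have hKc : Continuous fun q : ℍ => q.imK := Quaternion.continuous_imK
  have hub : ∀ {f : (ℍ × ℍ) × ℍ → ℍ}, Measurable f →
      MeasurableSet {w : (ℍ × ℍ) × ℍ | 4 * (a.imI ^ 2 * ((f w).imJ ^ 2 + (f w).imK ^ 2)) ≤ dilNormSq s (f w) * ‖a‖ ^ 2} :=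
    fun hf => measurableSet_le ((((hc hf _ hJc).pow_const 2).add ((hc hf _ hKc).pow_const 2)).const_mul _ |>.const_mul _)
      ((hN hf).mul measurable_const)
  have cpl : ∀ {f g : (ℍ × ℍ) × ℍ → ℍ}, Measurable f → Measurable g →
      MeasurableSet {w : (ℍ × ℍ) × ℍ | 4 * (((f w).imK * (g w).imI - (f w).imI * (g w).imK) ^ 2 +
        ((f w).imI * (g w).imJ - (f w).imJ * (g w).imI) ^ 2 + s * ((f w).imJ * (g w).imK - (f w).imK * (g w).imJ) ^ 2) ≤
          dilNormSq s (f w) * dilNormSq s (g w)} := by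
    intro f g hf hg
    refine measurableSet_le ?_ ((hN hf).mul (hN hg))
    exact (((((hc hf _ hKc).mul (hc hg _ hI)).sub ((hc hf _ hI).mul (hc hg _ hKc))).pow_const 2 |>.add
      ((((hc hf _ hI).mul (hc hg _ hJc)).sub ((hc hf _ hJc).mul (hc hg _ hI))).pow_const 2)) |>.add
      (((((hc hf _ hJc).mul (hc hg _ hKc)).sub ((hc hf _ hKc).mul (hc hg _ hJc))).pow_const 2).const_mul s)).const_mul _
  unfold rescaledSet4
  exact (measurableSet_lt (hN hx) measurable_const).inter ((measurableSet_lt (hN hy) measurable_const).inter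
    ((measurableSet_lt (hN hz) measurable_const).inter ((hub hx).inter ((hub hy).inter ((hub hz).inter
      ((cpl hx hy).inter ((cpl hx hz).inter (cpl hy hz))))))))

/-- ★★ **THE EXACT `t⁶`-SCALING** at an axis hub: for `t > 0` and `a_J = a_K = 0`,
`φ⁴_t(a) = coneConst³·(t²)³·vol³(rescaledSet4 t² a)` — the Jacobian of the three transverse dilations is exactly the small-ball power of `N₄`. [folklore] -/
theorem phiFour_axis_eq_scaled {t : ℝ} (ht : 0 < t) {a : ℍ} (hJ : a.imJ = 0) (hK : a.imK = 0) :
    phiFour t a = (ENNReal.ofReal coneConst * ENNReal.ofReal coneConst * ENNReal.ofReal coneConst) *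
      ((ENNReal.ofReal (t ^ 2) * ENNReal.ofReal (t ^ 2) * ENNReal.ofReal (t ^ 2)) *
        (((volume : Measure ℍ).prod (volume : Measure ℍ)).prod (volume : Measure ℍ)) (rescaledSet4 (t ^ 2) a)) := by
  have ht0 : t ≠ 0 := ht.ne'
  have ht2 : 0 < t ^ 2 := by positivity
  have hD : Measurable (dilate t) := (LinearMap.continuous_of_finiteDimensional _).measurable
  have hD3 : Measurable (Prod.map (Prod.map (dilate t) (dilate t)) (dilate t)) := (hD.prodMap hD).prodMap hD
  set E := fourSet t a ∩ ((Metric.ball (0 : ℍ) 1 ×ˢ Metric.ball (0 : ℍ) 1) ×ˢ Metric.ball (0 : ℍ) 1) with hE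
  have hEm : MeasurableSet E := (measurableSet_fourSet t a).inter ((measurableSet_ball.prod measurableSet_ball).prod measurableSet_ball)
  have hpre : (Prod.map (Prod.map (dilate t) (dilate t)) (dilate t)) ⁻¹' E = rescaledSet4 (t ^ 2) a := by
    ext w; exact dilate3_mem_fourSet_iff ht hJ hK w
  -- `vol³(rescaledSet4) = vol³(D⁻¹ E) = (map D vol³) E = (t²)⁻³ vol³(E)`
  have hmap := map_dilate3_volume ht0
  have hvol : (((volume : Measure ℍ).prod (volume : Measure ℍ)).prod (volume : Measure ℍ)) (rescaledSet4 (t ^ 2) a) =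
      (ENNReal.ofReal ((t ^ 2)⁻¹) * ENNReal.ofReal ((t ^ 2)⁻¹) * ENNReal.ofReal ((t ^ 2)⁻¹)) *
        (((volume : Measure ℍ).prod (volume : Measure ℍ)).prod (volume : Measure ℍ)) E := by
    rw [← hpre, ← Measure.map_apply hD3 hEm, hmap, Measure.smul_apply, smul_eq_mul]
  rw [phiFour, coneThree_apply (measurableSet_fourSet t a), ← hE, hvol]
  have hinv : ENNReal.ofReal (t ^ 2) * ENNReal.ofReal ((t ^ 2)⁻¹) = 1 := by
    rw [← ENNReal.ofReal_mul ht2.le, mul_inv_cancel₀ ht2.ne', ENNReal.ofReal_one]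
  calc (ENNReal.ofReal coneConst * ENNReal.ofReal coneConst * ENNReal.ofReal coneConst) *
        (((volume : Measure ℍ).prod (volume : Measure ℍ)).prod (volume : Measure ℍ)) E
      = (ENNReal.ofReal coneConst * ENNReal.ofReal coneConst * ENNReal.ofReal coneConst) *
          ((ENNReal.ofReal (t ^ 2) * ENNReal.ofReal ((t ^ 2)⁻¹)) * (ENNReal.ofReal (t ^ 2) * ENNReal.ofReal ((t ^ 2)⁻¹)) *
            (ENNReal.ofReal (t ^ 2) * ENNReal.ofReal ((t ^ 2)⁻¹)) *
            (((volume : Measure ℍ).prod (volume : Measure ℍ)).prod (volume : Measure ℍ)) E) := by rw [hinv]; ring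
    _ = _ := by ring

/-- The rescaled event is jointly measurable in `(a, w)` at the axis hub. [folklore] -/
theorem measurableSet_rescaledSet4_axis_joint (s : ℝ) :
    MeasurableSet {q : ℍ × ((ℍ × ℍ) × ℍ) | q.2 ∈ rescaledSet4 s (axisPoint q.1)} := by
  have ha : Measurable fun q : ℍ × ((ℍ × ℍ) × ℍ) => q.1 := measurable_fst
  have hx : Measurable fun q : ℍ × ((ℍ × ℍ) × ℍ) => q.2.1.1 := (measurable_fst.comp measurable_fst).comp measurable_snd
  have hy : Measurable fun q : ℍ × ((ℍ × ℍ) × ℍ) => q.2.1.2 := (measurable_snd.comp measurable_fst).comp measurable_snd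
  have hz : Measurable fun q : ℍ × ((ℍ × ℍ) × ℍ) => q.2.2 := measurable_snd.comp measurable_snd
  have hN : ∀ {f : ℍ × ((ℍ × ℍ) × ℍ) → ℍ}, Measurable f → Measurable fun q => dilNormSq s (f q) := fun hf => (continuous_dilNormSq s).measurable.comp hf
  have hc : ∀ {f : ℍ × ((ℍ × ℍ) × ℍ) → ℍ}, Measurable f → ∀ (g : ℍ → ℝ), Continuous g → Measurable fun q => g (f q) :=
    fun hf g hg => hg.measurable.comp hf
  have hI : Continuous fun q : ℍ => q.imI := Quaternion.continuous_imI
  have hJc : Continuous fun q : ℍ => q.imJ := Quaternion.continuous_imJ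
  have hKc : Continuous fun q : ℍ => q.imK := Quaternion.continuous_imK
  have hm : Measurable fun q : ℍ × ((ℍ × ℍ) × ℍ) => (axisPoint q.1).imI := by
    have : (fun q : ℍ × ((ℍ × ℍ) × ℍ) => (axisPoint q.1).imI) = fun q => ‖q.1.im‖ := rfl
    rw [this]; exact (continuous_norm.comp (Quaternion.continuous_im.comp continuous_fst)).measurable
  have hna : Measurable fun q : ℍ × ((ℍ × ℍ) × ℍ) => ‖axisPoint q.1‖ ^ 2 := by
    have : (fun q : ℍ × ((ℍ × ℍ) × ℍ) => ‖axisPoint q.1‖ ^ 2) = fun q => ‖q.1‖ ^ 2 := by funext q; rw [norm_axisPoint]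
    rw [this]; exact (continuous_norm.comp continuous_fst).measurable.pow_const 2
  have hub : ∀ {f : ℍ × ((ℍ × ℍ) × ℍ) → ℍ}, Measurable f →
      MeasurableSet {q : ℍ × ((ℍ × ℍ) × ℍ) | 4 * ((axisPoint q.1).imI ^ 2 * ((f q).imJ ^ 2 + (f q).imK ^ 2)) ≤ dilNormSq s (f q) * ‖axisPoint q.1‖ ^ 2} :=
    fun hf => measurableSet_le (((hm.pow_const 2).mul (((hc hf _ hJc).pow_const 2).add ((hc hf _ hKc).pow_const 2))).const_mul _)
      ((hN hf).mul hna)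
  have cpl : ∀ {f g : ℍ × ((ℍ × ℍ) × ℍ) → ℍ}, Measurable f → Measurable g →
      MeasurableSet {q : ℍ × ((ℍ × ℍ) × ℍ) | 4 * (((f q).imK * (g q).imI - (f q).imI * (g q).imK) ^ 2 +
        ((f q).imI * (g q).imJ - (f q).imJ * (g q).imI) ^ 2 + s * ((f q).imJ * (g q).imK - (f q).imK * (g q).imJ) ^ 2) ≤
          dilNormSq s (f q) * dilNormSq s (g q)} := by
    intro f g hf hg
    refine measurableSet_le ?_ ((hN hf).mul (hN hg))
    exact (((((hc hf _ hKc).mul (hc hg _ hI)).sub ((hc hf _ hI).mul (hc hg _ hKc))).pow_const 2 |>.add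
      ((((hc hf _ hI).mul (hc hg _ hJc)).sub ((hc hf _ hJc).mul (hc hg _ hI))).pow_const 2)) |>.add
      (((((hc hf _ hJc).mul (hc hg _ hKc)).sub ((hc hf _ hKc).mul (hc hg _ hJc))).pow_const 2).const_mul s)).const_mul _
  simp only [rescaledSet4, Set.mem_setOf_eq]
  exact (measurableSet_lt (hN hx) measurable_const).inter ((measurableSet_lt (hN hy) measurable_const).inter
    ((measurableSet_lt (hN hz) measurable_const).inter ((hub hx).inter ((hub hy).inter ((hub hz).inter
      ((cpl hx hy).inter ((cpl hx hz).inter (cpl hy hz))))))))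

/-- ★★ **`Haar⁴(N₄(t)) = t⁶ · coneConst³ · ∫ dcone(a) vol³(G⁴_{t²}(re a + ‖Im a‖·i))`** for `t > 0`: the small-ball power `t⁶` EXACTLY factored out; the
`log(1/t)` of the two-sided laws lives in the hub integral of the `t`-regular event. [cite: Luscher1983, §2] -/
theorem haar_nearlyCommuting_eq_scaled {t : ℝ} (ht : 0 < t) :
    (Measure.pi fun _ : Fin 4 => haarProbability (Matrix.specialUnitaryGroup (Fin 2) ℂ)) (nearlyCommuting t) =
      ENNReal.ofReal (t ^ 6) * ((ENNReal.ofReal coneConst * ENNReal.ofReal coneConst * ENNReal.ofReal coneConst) *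
        ∫⁻ a, (((volume : Measure ℍ).prod (volume : Measure ℍ)).prod (volume : Measure ℍ)) (rescaledSet4 (t ^ 2) (axisPoint a)) ∂coneMeasure) := by
  haveI := isProbabilityMeasure_coneMeasure
  rw [haar_nearlyCommuting_eq_lintegral_axis ht.le]
  have hax : ∀ a : ℍ, phiFour t (axisPoint a) = ENNReal.ofReal (t ^ 6) * ((ENNReal.ofReal coneConst * ENNReal.ofReal coneConst * ENNReal.ofReal coneConst) *
      (((volume : Measure ℍ).prod (volume : Measure ℍ)).prod (volume : Measure ℍ)) (rescaledSet4 (t ^ 2) (axisPoint a))) := by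
    intro a
    rw [phiFour_axis_eq_scaled ht (axisPoint_components a).2.2.1 (axisPoint_components a).2.2.2]
    have e6 : ENNReal.ofReal (t ^ 6) = ENNReal.ofReal (t ^ 2) * ENNReal.ofReal (t ^ 2) * ENNReal.ofReal (t ^ 2) := by
      rw [← ENNReal.ofReal_mul (sq_nonneg _), ← ENNReal.ofReal_mul (by positivity)]; ring_nf
    rw [e6]; ring
  simp_rw [hax]
  have hmeas : Measurable fun a : ℍ => (((volume : Measure ℍ).prod (volume : Measure ℍ)).prod (volume : Measure ℍ)) (rescaledSet4 (t ^ 2) (axisPoint a)) :=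
    measurable_measure_prodMk_left (measurableSet_rescaledSet4_axis_joint (t ^ 2))
  rw [lintegral_const_mul _ (hmeas.const_mul _), lintegral_const_mul _ hmeas]

end Summit.QuantumFields.YangMills.Theorems.SwapVirialDeficit.ZeroModeGroup

end
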